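import Summits.BirchSwinnertonDyer.BirchSwinnertonDyer.Theses.TameQuarticManinParity
import Literature.NumberTheory.Automorphic.WeightTwoNewformOrdinaryAtPInLevel
import Literature.NumberTheory.EllipticCurves.TorsionLevelLoweringGoodReductionProofs
import Literature.NumberTheory.Automorphic.SerreConjectureProofs
import Literature.NumberTheory.Automorphic.BCDTModularity
import Literature.NumberTheory.EllipticCurves.SzpiroLocalDataProofs
import Literature.NumberTheory.Automorphic.CDTTheorem722SerreLevelProofs
import Literature.NumberTheory.EllipticCurves.OrdinaryReductionTorsionLineProofs
import Literature.NumberTheory.GaloisRepresentations.ModPCyclotomicCharacterInertiaSurjective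
import Literature.NumberTheory.Automorphic.BCDTModularitySerreProofs
import HarnessLib

/-!
# Route `TameQuarticManinParity`: G33 `TprimeIrrLevelThirdAvoidsThreeOfNewformLift` (stmt-BirchSwinnertonDyer-23818) BY NAME —
# the Serre-weight contradiction closing L31 `TprimeIrrLevelThirdAvoidsThree` (stmt-23690) from its print leaves

Lead seat `cruxlead-stmt-BirchSwinnertonDyer-23367` (crux MS `TprimeIrrModThreeSaturation`, line `abelian-fixed-points`), landing
the pen's LINE 33 glue (bsd-idea-3 g10, `LINE33_L31_of.lean`, critic VERDICT #202 PASS) verbatim up to namespace/docstrings.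
L31 is the crux's registered stub `stub_levelThirdAvoidsThree`; this file proves the IMPLICATION
`hE → hD → LIFT33 → CONG33 → W23b → L31` (the route decl G33), i.e. L31 modulo: the two catalogued named facts
`edixhoven1992_serreWeight_le_weight_of_newform`, `darmonDiamondTaylor1995_ordinary_of_weightTwo_newform_dvd_level`, the W-free
Deligne–Serre lift LIFT33 (stmt-23816; analytic half landed by typer defn-ty1 g30) and the Galois separation CONG33 (stmt-23817;
reduced by LINE 34 to finiteness + the everywhere-congruent case).  W23b is LANDED (p679313).  THEOREMS ONLY; no definition,
no named fact, no `sorry`.  No summit is proved; BSD is NOT proved.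
-/

set_option autoImplicit false
-- D-0017: single-problem summit, so `Summit.BirchSwinnertonDyer.BirchSwinnertonDyer.…` repeats a namespace BY DESIGN.
set_option linter.dupNamespace false

noncomputable section

namespace Summit.BirchSwinnertonDyer.BirchSwinnertonDyer.Theorems.TameQuarticManinParity

open Summit.BirchSwinnertonDyer.BirchSwinnertonDyer.Theses.TameQuarticManinParity

open scoped Classical MatrixGroups ModularForm NumberField
open Literature.NumberTheory Literature.NumberTheory.GaloisRepresentations
  Literature.NumberTheory.EllipticCurves Literature.NumberTheory.EllipticCurves.ModularForms
  Literature.NumberTheory.Automorphic Literature.NumberTheory.DiophantineGeometry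
  Literature.NumberTheory.GaloisRepresentations.ModPGaloisRep
  Literature.NumberTheory.GaloisRepresentations.IsNonarchimedeanLocalField ValuativeRel IsDedekindDomain

set_option maxHeartbeats 1000000 in
/-- **The Serre-conjecture inputs of `ρ̄_{W,3}`** (TORS33): for an elliptic `W/ℚ` with `E[3]` irreducible and a framed
model `ρ̄` of `E[3]`, the base change `ρ̄ ⊗ k` to an algebraically closed `k` of characteristic `3` is IRREDUCIBLE
(absolute irreducibility for `p ≠ 2`, `BCDT.isAbsolutelyIrreducible_of_hasIrreducibleModPGaloisRep`), ODD (`det = χ̄₃` by the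
Weil pairing, `det_eq_modPCyclotomicCharacter_of_isTorsionGaloisRep_holds`), and at every local restriction datum at `3` some
inertia element has `det ≠ 1` (`χ̄₃(I_{ℚ₃}) = 𝔽₃ˣ`, `exists_mem_absInertia_modPCyclotomicCharacterZMod_eq`).  All proved in
the tree; assembled by the pen bsd-idea-3 g10 (LINE 33). [cite: Serre1987, §3.2 (oddness and absolute irreducibility of ρ̄_{E,p})] -/
theorem torsionRepAtThree_serreInputs (W : WeierstrassCurve ℚ) [W.IsElliptic]
    (hirr : W.HasIrreducibleModPGaloisRep 3) (ρ : ModPGaloisRep ℚ (ZMod 3) 2)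
    (hρ : W.IsTorsionGaloisRep 3 ρ) (k : Type) [Field k] [TopologicalSpace k] [DiscreteTopology k]
    [CharP k 3] [IsAlgClosed k] (j : ZMod 3 →+* k) :
    (FramedGaloisRep.toGaloisRep (FramedRep.baseChange j continuous_of_discreteTopology ρ)).IsIrreducible ∧
    FramedGaloisRep.IsOdd (FramedRep.baseChange j continuous_of_discreteTopology ρ) ∧
    ∀ loc : LocalRestrictionAt 3 (FramedRep.baseChange j continuous_of_discreteTopology ρ),
      ∃ σ ∈ absInertia loc.F, Matrix.GeneralLinearGroup.det (loc.rep σ) ≠ 1 := by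
  haveI : NeZero ((3 : ℕ) : ℚ) := ⟨by norm_num⟩
  have habs := Literature.NumberTheory.Automorphic.BCDT.isAbsolutelyIrreducible_of_hasIrreducibleModPGaloisRep
    W (p := 3) (by decide) hirr hρ
  have hdet := W.det_eq_modPCyclotomicCharacter_of_isTorsionGaloisRep_holds 3 ρ hρ
  refine ⟨?_, ?_, ?_⟩
  · rw [← ModPGaloisRep.isIrreducible_iff_toGaloisRep]
    exact habs.isIrreducible_baseChange k j _
  · exact (ModPGaloisRep.isOdd_of_det_eq_modPCyclotomicCharacterZMod ρ hdet).baseChange j _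
  · intro loc
    haveI : CharZero loc.F := charZero_of_injective_algebraMap (algebraMap ℚ loc.F).injective
    haveI : NeZero ((3 : ℕ) : loc.F) := NeZero.charZero
    obtain ⟨σ, hσ, hχ⟩ := exists_mem_absInertia_modPCyclotomicCharacterZMod_eq (F := loc.F) (p := 3)
      loc.irreducible_natCast loc.residueFieldCard_eq (-1)
    refine ⟨σ, hσ, fun h1 => ?_⟩
    rw [loc.rep_apply, FramedRep.baseChange_apply, Matrix.GeneralLinearGroup.map_det, hdet,
      modPCyclotomicCharacterZMod_absGaloisRestrict ℚ loc.F 3 σ, hχ] at h1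
    have h2 := congrArg (fun u : kˣ => (u : k)) h1
    simp only [Units.coe_map, MonoidHom.coe_coe, Units.val_neg, Units.val_one, map_neg, map_one] at h2
    -- `-1 = 1` in characteristic `3` is absurd
    have h3 : (2 : k) = 0 := by
      have : (1 : k) + 1 = 0 := by
        calc (1 : k) + 1 = -1 + 1 := by rw [h2]
          _ = 0 := by ring
      calc (2 : k) = 1 + 1 := by norm_num
        _ = 0 := this
    have h4 : ((2 : ℕ) : k) = 0 := by exact_mod_cast h3
    rw [CharP.cast_eq_zero_iff k 3] at h4
    omega


set_option maxHeartbeats 1000000 in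
/-- **G33 `TprimeIrrLevelThirdAvoidsThreeOfNewformLift` (stmt-BirchSwinnertonDyer-23818) by name — LINE 33 glue, kernel-checked**:
`edixhoven1992_serreWeight_le_weight_of_newform → darmonDiamondTaylor1995_ordinary_of_weightTwo_newform_dvd_level →
ModThreePeriodEigenclassLiftsToNewform (LIFT33, 23816) → TprimeIrrCongruentNewformCarriesTorsionRep (CONG33, 23817) →
TprimeIrrKodairaThreeSerreWeightSix (W23b, 28281, landed p679313) → TprimeIrrLevelThirdAvoidsThree (L31, 23690)`.  Proof: a
non-`3`-divisible mod-`3` eigenclass `y ∈ H₁(X₀(N/3), ℤ)` lifts to a `Γ₁(M′)`-newform `g`, `M′ ∣ N/3`, trivial character,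
congruent to `W` on `S` (LIFT33); congruence on the separating set `S` makes `ρ̄_{W,3} ⊗ 𝔽̄₃` arise from `g` (CONG33); `9 ∤ M′`,
so Edixhoven + DDT give Serre weight `≤ 4` at the `3`-adic datum (`serreWeight_le_add_one_of_weightTwo_newform`), against
`6` (W23b). [cite: Edixhoven1992, Thm. 4.5] [cite: DarmonDiamondTaylor1995, Thm. 3.1 (g) (p. 86)] -/
theorem levelThirdAvoidsThree_of_newformLift : TprimeIrrLevelThirdAvoidsThreeOfNewformLift := by
  intro hE hD hLift hCong hW6 W _ _ _ hCM hadd hsub hirr hv3 h9 _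
  classical
  obtain ⟨S, hSp, hS⟩ := hCong W hirr
  refine ⟨S, fun p hp hpN => (hSp p hp).2 (dvd_mul_of_dvd_right hpN 3), ?_⟩
  intro y hy
  by_contra hne
  -- coefficients: `k = 𝔽̄₃` with the discrete topology
  letI : TopologicalSpace (AlgebraicClosure (ZMod 3)) := ⊥
  haveI : DiscreteTopology (AlgebraicClosure (ZMod 3)) := ⟨rfl⟩
  have hNz : W.conductorNorm ℤ ≠ 0 := NeZero.ne _
  have h3N : 3 ∣ W.conductorNorm ℤ := dvd_trans (dvd_pow_self 3 two_ne_zero) h9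
  -- (1) the Deligne–Serre lift of the non-divisible eigenclass `y` at level `N/3`
  obtain ⟨M', hM'0, hM'M, g, ιg, hg, hε, hcong⟩ :=
    hLift (W.conductorNorm ℤ / 3) S (fun p => W.LFunction p) ⟨y, hne, hy⟩ (AlgebraicClosure (ZMod 3))
  have hM'N : M' ∣ W.conductorNorm ℤ := hM'M.trans (Nat.div_dvd_of_dvd h3N)
  -- (2) a framed model of `E[3]` and its base change to `𝔽̄₃`
  haveI : NeZero ((3 : ℕ) : ℚ) := ⟨by norm_num⟩
  obtain ⟨ρ, hρ⟩ := WeierstrassCurve.exists_isTorsionGaloisRep W 3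
  set j : ZMod 3 →+* AlgebraicClosure (ZMod 3) := algebraMap (ZMod 3) (AlgebraicClosure (ZMod 3))
    with hj
  obtain ⟨hirr', hodd', hdet'⟩ := torsionRepAtThree_serreInputs W hirr ρ hρ (AlgebraicClosure (ZMod 3)) j
  -- (3) congruence on `S` ⇒ `ρ̄_E ⊗ 𝔽̄₃` arises from `g`
  have hgal := hS (AlgebraicClosure (ZMod 3)) j M' hM'N g ιg hg (fun p hp => by
      have hp3N := (hSp p hp).2
      have hp3 : p ≠ 3 := by
        rintro rfl; exact hp3N (dvd_mul_right 3 _)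
      have hpM : ¬ p ∣ W.conductorNorm ℤ / 3 := fun h =>
        hp3N (dvd_mul_of_dvd_right (h.trans (Nat.div_dvd_of_dvd h3N)) 3)
      exact hcong p hp (hSp p hp).1 hp3 hpM) ρ hρ
  -- (4) the `3`-adic local datum, a residue embedding, `9 ∤ M'`, trivial character
  set ρ' := FramedRep.baseChange j continuous_of_discreteTopology ρ with hρ'
  obtain ⟨v, hv⟩ : ∃ v : IsDedekindDomain.HeightOneSpectrum (NumberField.RingOfIntegers ℚ),
      Rat.HeightOneSpectrum.primesEquiv v = ⟨3, Nat.prime_three⟩ :=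
    ⟨(Rat.HeightOneSpectrum.primesEquiv (R := NumberField.RingOfIntegers ℚ)).symm ⟨3, Nat.prime_three⟩,
      Equiv.apply_symm_apply _ _⟩
  have hpv' : ((3 : ℕ) : NumberField.RingOfIntegers ℚ) ∈ v.asIdeal :=
    (Literature.NumberTheory.Automorphic.BCDT.natCast_mem_asIdeal_iff_primesEquiv_eq v Nat.prime_three).mpr (by rw [hv])
  let loc : LocalRestrictionAt 3 ρ' :=
    { F := v.adicCompletion ℚ
      residueFieldCard_eq := residueFieldCard_adicCompletion_eq_of_natCast_mem hpv'
      irreducible_natCast := irreducible_natCast_valuativeInteger_adicCompletion_of_natCast_mem hpv'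
      rep := FramedGaloisRep.restrictField (v.adicCompletion ℚ) ρ'
      rep_eq_restrictField := rfl }
  obtain ⟨ι⟩ := nonempty_ringHom_residue (k := AlgebraicClosure (ZMod 3)) 3 (v.adicCompletion ℚ)
    (residueFieldCard_adicCompletion_eq_of_natCast_mem hpv')
  have hf3 : (W.conductorNorm ℤ).factorization 3 = 2 := by
    have e := WeierstrassCurve.factorization_conductorNorm_primesEquiv_symm W ⟨3, Nat.prime_three⟩
    rw [e]
    exact hsub.2.1
  have h9M' : ¬ 3 ^ 2 ∣ M' := by
    intro h
    have h27 : 3 ^ 3 ∣ W.conductorNorm ℤ := by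
      have : 3 * 3 ^ 2 ∣ 3 * (W.conductorNorm ℤ / 3) := Nat.mul_dvd_mul_left 3 (h.trans hM'M)
      rwa [Nat.mul_div_cancel' h3N] at this
    have := (Nat.prime_three.pow_dvd_iff_le_factorization hNz).mp h27
    omega
  have hψ : ¬ 3 ∣ (nebentypus g).conductor := by
    rw [hε, DirichletCharacter.conductor_one]
    omega
  -- (5) Edixhoven + DDT: `k(ρ̄) ≤ 4`; W23b: `k(ρ̄) = 6`
  have hle := serreWeight_le_add_one_of_weightTwo_newform hE hD 3 (by decide) g hg h9M' hψ
    (AlgebraicClosure (ZMod 3)) ρ' hirr' hodd' ιg hgal loc ι (hdet' loc)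
  have h6 := hW6 W hadd hsub hirr hv3 ρ hρ (AlgebraicClosure (ZMod 3)) j loc ι
  rw [h6] at hle
  omega


end Summit.BirchSwinnertonDyer.BirchSwinnertonDyer.Theorems.TameQuarticManinParity

end
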